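import Literature.NumberTheory.Automorphic.IdeleClassBaseChangeInfinite
import Literature.NumberTheory.Automorphic.InfiniteIdelePolar
import Mathlib.NumberTheory.NumberField.CMField
import HarnessLib

/-!
# Positive-real infinite idèle classes of `L` come from `K` (e.g. `L/L⁺` CM)

Topic `NumberTheory/Automorphic`; namespace `Literature.NumberTheory.Automorphic`. One definition
(`realToCompletion K v : ℝ →+* K_v`, the canonical copy of `ℝ` in each archimedean completion) and theorems; everything
is proved, no named fact, no instance.

For a finite extension of number fields `L/K`, `ι = classBaseChange K L : C_K → C_L`, and the positive-real infinite
idèles `posRealUnits L ≤ L_∞ˣ` of `InfiniteIdelePolar.lean` (every component a positive real under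
`extensionEmbedding`):

* `realToCompletion K v`, `extensionEmbedding_realToCompletion` (`K_v → ℂ` restricts to the identity on this `ℝ`),
  `continuous_realToCompletion`, `ringHom_real_eq` (two continuous ring maps `ℝ → R` into a Hausdorff division
  ring agree), `infiniteCompletionOfComap_realToCompletion` (**the local base change `K_v → L_w` fixes `ℝ`**);
* **`exists_infiniteIdeleBaseChange_eq_of_mem_posRealUnits`**: if `w ↦ w|_K` is injective on the infinite places of
  `L` (every infinite place of `K` has at most one place of `L` above it), every `p ∈ posRealUnits L` is a base
  change `p = y_L`, `y ∈ K_∞ˣ` (`y_v = p_{w(v)} ∈ ℝ_{>0}`); hence `posRealToClass_range_le_range_classBaseChange` —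
  **`[posRealUnits L] ≤ ι(C_K)`**, the hypothesis `hpos` of `IdeleClassGroup.exists_ideleClassChar_of_isProperMap'`
  for `f = ι` — and, with the polar decomposition of `InfiniteIdelePolar.lean`
  (`IdeleClassGroup.hpolar_of_posRealUnits_le`), `range_infUnitsToClass_le_range_classBaseChange_sup` —
  **`[L_∞ˣ] ≤ ι(C_K) ⊔ [T_L]`** (`hpolar`);
* the CM case `K = L⁺ = maximalRealSubfield L` (Mathlib `IsCMField.equivInfinitePlace`: `w ↦ w|_{L⁺}` is a
  bijection): `comap_injective_of_isCMField`, `posRealToClass_range_le_range_classBaseChange_maximalRealSubfield`,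
  `range_infUnitsToClass_le_of_isCMField` — PerL v5 §3.2, tex l. 312: "`z = |z|·(z/|z|)` with `|z| ∈ ℝ_{>0} ⊂ L×_{0,v}`".

Provenance: tree-vocabulary form of the `pub-hodgecm` package files `HodgeCM/PerL34/ClassNormProper.lean` §"the
canonical copy of `ℝ`" (DAG-node prover #10 lineage: `realToCompletion`, `extensionEmbedding_realToCompletion`) and
`HodgeCM/Literature/ClassBaseChangePolar.lean` + `ClassBaseChange.lean` §0/§2 (CITED-FACT seat gen 5: `ringHom_real_eq`,
`infiniteCompletionOfComap_realToCompletion`, `exists_ideleBaseChange_eq_of_mem_posRealUnits`, `hpolar_classBaseChange(_of_isCMField)`),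
over the tree's `classBaseChange` / `infUnitsToClass` / `posRealUnits`.

## References

* A. Weil, *Basic Number Theory* (1967), Ch. IV §4 (the polar part of `k_𝔸ˣ` at infinity). [WeilBNT1967]
-/

noncomputable section

open NumberField NumberField.InfinitePlace NumberField.InfinitePlace.Completion

namespace Literature.NumberTheory.Automorphic

open GaloisRepresentations

/-! ## The canonical copy of `ℝ` in each `K_v` -/

section Real

variable (K : Type) [Field K]

open scoped Classical in
/-- **`ℝ →+* K_v`**: the inverse of `K_v ≃+* ℝ` at a real place, `ℝ ⊂ ℂ ≃+* K_v` at a complex place. [folklore] -/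
def realToCompletion (v : InfinitePlace K) : ℝ →+* v.Completion :=
  if hv : IsReal v then (ringEquivRealOfIsReal hv).symm.toRingHom
  else ((ringEquivComplexOfIsComplex (not_isReal_iff_isComplex.mp hv)).symm.toRingHom).comp Complex.ofRealHom

/-- `K_v → ℂ` is the identity on the canonical `ℝ`: `extensionEmbedding v (realToCompletion K v r) = r`. [folklore] -/
@[simp]
theorem extensionEmbedding_realToCompletion (v : InfinitePlace K) (r : ℝ) :
    extensionEmbedding v (realToCompletion K v r) = (r : ℂ) := by
  unfold realToCompletion
  split_ifs with hv
  · rw [RingEquiv.toRingHom_eq_coe, RingHom.coe_coe, ← extensionEmbeddingOfIsReal_apply hv,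
      ← ringEquivRealOfIsReal_apply hv, RingEquiv.apply_symm_apply]
  · rw [RingHom.comp_apply, RingEquiv.toRingHom_eq_coe, RingHom.coe_coe,
      ← ringEquivComplexOfIsComplex_apply (not_isReal_iff_isComplex.mp hv), RingEquiv.apply_symm_apply]
    rfl

/-- At a real place, `realToCompletion` inverts `ringEquivRealOfIsReal`. [folklore] -/
theorem ringEquivRealOfIsReal_realToCompletion {v : InfinitePlace K} (hv : IsReal v) (r : ℝ) :
    ringEquivRealOfIsReal hv (realToCompletion K v r) = r := by
  apply Complex.ofReal_injective
  rw [ringEquivRealOfIsReal_apply, extensionEmbeddingOfIsReal_apply, extensionEmbedding_realToCompletion]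

/-- `‖realToCompletion K v r‖ = |r|`. [folklore] -/
theorem norm_realToCompletion (v : InfinitePlace K) (r : ℝ) : ‖realToCompletion K v r‖ = ‖r‖ := by
  rw [← InfiniteAdeleRing.norm_extensionEmbedding K v, extensionEmbedding_realToCompletion, Complex.norm_real]

/-- `realToCompletion K v` is an isometry, hence continuous. [folklore] -/
theorem isometry_realToCompletion (v : InfinitePlace K) : Isometry (realToCompletion K v) :=
  AddMonoidHomClass.isometry_of_norm _ (norm_realToCompletion K v)

/-- `realToCompletion K v` is continuous. [folklore] -/
theorem continuous_realToCompletion (v : InfinitePlace K) : Continuous (realToCompletion K v) :=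
  (isometry_realToCompletion K v).continuous

/-- `realToCompletion K v r ≠ 0` for `r ≠ 0`. [folklore] -/
theorem realToCompletion_ne_zero (v : InfinitePlace K) {r : ℝ} (hr : r ≠ 0) : realToCompletion K v r ≠ 0 :=
  (map_ne_zero _).2 hr

/-- **Two continuous ring homomorphisms `ℝ → R` into a Hausdorff division ring coincide** (they agree on the dense
subfield `ℚ`). [folklore] -/
theorem ringHom_real_eq {R : Type*} [DivisionRing R] [TopologicalSpace R] [T2Space R]
    {f g : ℝ →+* R} (hf : Continuous f) (hg : Continuous g) : f = g := by
  refine RingHom.ext fun r => congrFun (Rat.denseRange_cast.equalizer hf hg ?_) r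
  funext q
  simp only [Function.comp_apply, map_ratCast]

end Real

/-! ## The local base change fixes `ℝ`; positive-real idèles are base changes -/

section BaseChange

variable (K L : Type) [Field K] [Field L] [Algebra K L]

/-- **`K_v → L_w` fixes the canonical copy of `ℝ`** (`w ∣ v`): `ℝ → K_v → L_w` and `ℝ → L_w` are continuous ring maps,
hence equal. [folklore] -/
theorem infiniteCompletionOfComap_realToCompletion (w : InfinitePlace L) (r : ℝ) :
    infiniteCompletionOfComap K L w (realToCompletion K (w.comap (algebraMap K L)) r) = realToCompletion L w r := by
  have h : (infiniteCompletionOfComap K L w).comp (realToCompletion K (w.comap (algebraMap K L))) =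
      realToCompletion L w :=
    ringHom_real_eq ((continuous_infiniteCompletionOfComap K L w).comp (continuous_realToCompletion K _))
      (continuous_realToCompletion L w)
  exact RingHom.congr_fun h r

variable [NumberField K] [NumberField L]

omit [NumberField K] in
/-- **Positive-real infinite idèles of `L` are base changes from `K`**, provided every infinite place of `K` has at
most one place of `L` above it: for `p ∈ posRealUnits L` there is `y ∈ K_∞ˣ` with `y_L = p` (take
`y_v = p_{w} ∈ ℝ_{>0}` for the place `w` above `v`, and `y_v = 1` if there is none). [cite: WeilBNT1967, Ch. IV §4] -/
theorem exists_infiniteIdeleBaseChange_eq_of_mem_posRealUnits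
    (hinj : Function.Injective fun w : InfinitePlace L => w.comap (algebraMap K L))
    {p : (InfiniteAdeleRing L)ˣ} (hp : p ∈ InfiniteAdeleRing.posRealUnits L) :
    ∃ y : (InfiniteAdeleRing K)ˣ, infiniteIdeleBaseChange K L y = p := by
  classical
  choose r hr0 hr using hp
  -- the real coordinates on `K`: `s v = r w` for the place `w` above `v` (if any), else `1`
  let s : InfinitePlace K → ℝ := fun v =>
    if h : ∃ w : InfinitePlace L, w.comap (algebraMap K L) = v then r h.choose else 1
  have hs0 : ∀ v, s v ≠ 0 := fun v => by
    simp only [s]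
    split_ifs with h
    · exact (hr0 _).ne'
    · exact one_ne_zero
  have hsw : ∀ w : InfinitePlace L, s (w.comap (algebraMap K L)) = r w := fun w => by
    have h : ∃ w' : InfinitePlace L, w'.comap (algebraMap K L) = w.comap (algebraMap K L) := ⟨w, rfl⟩
    simp only [s, dif_pos h]
    rw [hinj h.choose_spec]
  -- the infinite idèle `y = (s_v)_v` of `K`
  let y : (InfiniteAdeleRing K)ˣ :=
    ⟨fun v => realToCompletion K v (s v), fun v => (realToCompletion K v (s v))⁻¹,
      funext fun v => mul_inv_cancel₀ (realToCompletion_ne_zero K v (hs0 v)),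
      funext fun v => inv_mul_cancel₀ (realToCompletion_ne_zero K v (hs0 v))⟩
  refine ⟨y, Units.ext (funext fun w => ?_)⟩
  rw [infiniteIdeleBaseChange_apply]
  change infiniteCompletionOfComap K L w (realToCompletion K _ (s (w.comap (algebraMap K L)))) = _
  rw [hsw, infiniteCompletionOfComap_realToCompletion]
  -- `p_w` and `realToCompletion L w (r w)` have the same image `r w` in `ℂ`
  apply (isometry_extensionEmbedding w).injective
  rw [extensionEmbedding_realToCompletion, hr w]

/-- The class of a positive-real infinite idèle of `L` lies in `ι(C_K)`. [folklore] -/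
theorem infUnitsToClass_mem_range_classBaseChange_of_mem_posRealUnits
    (hinj : Function.Injective fun w : InfinitePlace L => w.comap (algebraMap K L))
    {p : (InfiniteAdeleRing L)ˣ} (hp : p ∈ InfiniteAdeleRing.posRealUnits L) :
    infUnitsToClass L p ∈ (classBaseChange K L).range := by
  obtain ⟨y, rfl⟩ := exists_infiniteIdeleBaseChange_eq_of_mem_posRealUnits K L hinj hp
  exact ⟨infUnitsToClass K y, classBaseChange_infUnitsToClass K L y⟩

/-- **`[posRealUnits L] ≤ ι(C_K)`** (hypothesis `hpos` of `IdeleClassGroup.exists_ideleClassChar_of_isProperMap'` for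
`f = classBaseChange K L`), when `w ↦ w|_K` is injective on infinite places. [cite: WeilBNT1967, Ch. IV §4] -/
theorem posRealToClass_range_le_range_classBaseChange
    (hinj : Function.Injective fun w : InfinitePlace L => w.comap (algebraMap K L)) :
    (IdeleClassGroup.posRealToClass L).range ≤ (classBaseChange K L).range := by
  rintro _ ⟨p, rfl⟩
  rw [IdeleClassGroup.posRealToClass_apply]
  exact infUnitsToClass_mem_range_classBaseChange_of_mem_posRealUnits K L hinj p.2

/-- **`[L_∞ˣ] ≤ ι(C_K) ⊔ [T_L]`** (hypothesis `hpolar` of `IdeleClassGroup.exists_ideleClassChar_of_isProperMap` for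
`f = classBaseChange K L`): every infinite idèle class of `L` is an `ι(C_K)`-class times a norm-one-torus class, when
`w ↦ w|_K` is injective on infinite places. [cite: WeilBNT1967, Ch. IV §4] -/
theorem range_infUnitsToClass_le_range_classBaseChange_sup
    (hinj : Function.Injective fun w : InfinitePlace L => w.comap (algebraMap K L)) :
    (infUnitsToClass L).range ≤ (classBaseChange K L).range ⊔ (IdeleClassGroup.torusToClass L).range :=
  IdeleClassGroup.hpolar_of_posRealUnits_le L _ (posRealToClass_range_le_range_classBaseChange K L hinj)

end BaseChange

/-! ## The CM case `K = L⁺` -/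

section CM

variable (L : Type) [Field L] [NumberField L] [IsCMField L]

/-- For a CM field, `w ↦ w|_{L⁺}` is injective (indeed bijective, Mathlib `IsCMField.equivInfinitePlace`) on the
infinite places. [folklore] -/
theorem comap_injective_of_isCMField :
    Function.Injective fun w : InfinitePlace L => w.comap (algebraMap (maximalRealSubfield L) L) :=
  (IsCMField.equivInfinitePlace L).injective

/-- **CM case: `[posRealUnits L] ≤ ι(C_{L⁺})`.** [cite: WeilBNT1967, Ch. IV §4] -/
theorem posRealToClass_range_le_range_classBaseChange_maximalRealSubfield :
    (IdeleClassGroup.posRealToClass L).range ≤ (classBaseChange (maximalRealSubfield L) L).range :=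
  posRealToClass_range_le_range_classBaseChange _ L (comap_injective_of_isCMField L)

/-- **CM case: `[L_∞ˣ] ≤ ι(C_{L⁺}) ⊔ [T_L]`** — "`z = |z|·(z/|z|)` with `|z| ∈ ℝ_{>0} ⊂ L⁺_v`".
[cite: WeilBNT1967, Ch. IV §4] -/
theorem range_infUnitsToClass_le_of_isCMField :
    (infUnitsToClass L).range ≤
      (classBaseChange (maximalRealSubfield L) L).range ⊔ (IdeleClassGroup.torusToClass L).range :=
  range_infUnitsToClass_le_range_classBaseChange_sup _ L (comap_injective_of_isCMField L)

end CM

end Literature.NumberTheory.Automorphic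

end
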